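import Summits.QuantumFields.YangMills.Theorems.SmallFieldWideningLargeFieldMassRefinementTailBoundedRuns

/-!
# Route `SmallFieldWidening` — crux r3 `LargeFieldMassRefinementTail` (stmt-QuantumFields-22884): THE `J₀` FINEST BLOCK-AVERAGED HEIGHTS
# OF EVERY RUN ARE IDLE, UNIFORMLY IN THE RUN — the crux is exactly its COARSE-heights part
# (support file, leaf; width seat `ym-line-sfw-p2-w3` gen 3, line `birth` v5; the crux stays open)

Sharpening of the companion files `…BoundedRuns` (runs `K ≤ J`) and its `bareMass_refine_null` (height `j = 0`): for every FIXED
`J₀`, the Gibbs mass of «some block-averaged plaquette at a height `j ≤ min(K, J₀)` of run `K` of `F.refine n` is `θ(K−j)`-large» is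
`≤ δ n → 0` UNIFORMLY IN THE RUN `K` — with no hypothesis.  Reason: the heights `j ≤ J₀` of run `K` of `F.refine n` are, on the base
family, heights at DISTANCE `K + n − j ≥ n` from the unit scale, where the bounded-height per-plaquette tail
(`HistoryTailBoundedHeight`, crude Prop 1 for (0.4) iterated `≤ J₀` times + chessboard) is the term of a convergent series
(`LargeFieldMassRefinementTail.summable_term`) — its `n`-tail bounds the sum whatever `K` is.

* §1 transport with free top steps (`gibbsK_refine_real_compl_histGood_free`): run `K` of `F.refine d` with `s` free top steps IS
  run `K + d` of `F` with `s + d` free top steps (the companion `…OfHeightTail` did `s = 0`); the heights `j ≤ min(K, J₀)` of run `K`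
  are the UV-small-history event `histGood … K (K − J₀)` (`K − J₀` free top steps, truncated subtraction: all heights when `K ≤ J₀`).
* §2 `refinedMass_lowHeights_le_tsum` — from a per-height profile `q` of ONE family at the heights `≤ J₀`:
  `Gibbs^{F.refine d}_K((histGood (F.refine d) θ K (K − J₀))ᶜ) ≤ Σ_{t ≥ 0} q(t + d)` for ALL `K`.
* §3 **`refinedMass_null_lowHeights`** (`∃ δ → 0, ∀ n K, γL^{-n} ≤ 1 → Gibbs^{F.refine n}_K((histGood (F.refine n) θ K (K − J₀))ᶜ) ≤ δ n`,
  every `J₀`, family, coupling, profile `b₀ > 0`, `p₀ ≥ 1`) and **`largeFieldMassRefinementTail_lowHeights J₀`** — the crux's own text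
  with `histGood … K 0` (all heights) replaced by `histGood … K (K − J₀)` (the `J₀ + 1` finest heights), PROVED; the crux is `J₀ = K`.
* §4 **`largeFieldMassRefinementTail_iff_highHeights J₀`** — r3 ⇔ r3 for the heights `J₀ < j ≤ K` only (fields averaged over more
  than `J₀` block-averaging steps): the open content of the crux is the large-field improbability of the COARSE averaged fields, jointly
  in `(j, K)` with `j > J₀` arbitrary — [Balaban1985UV3] (71)'s unprinted probability bound, i.e. crux K2's wall; `J₀ ↛ K` here because
  the deterministic propagation loses `(151L²)²/L` per step in the Gaussian exponent.

WHAT THIS IS NOT: not the crux, no estimate uniform in the height, nothing on the Yang–Mills mass gap (record rung R3 only, not proved).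

References: T. Bałaban, CMP 102 (1985) 255–275 [Balaban1985UV3] ((1)–(3) p.256, (7) p.257, (71) p.273); CMP 98 (1985) 17–51
[Balaban1985Averaging] (Prop. 1 (51) p.26).
-/

noncomputable section

open MeasureTheory Filter Topology
open scoped BigOperators
open Literature.MathematicalPhysics.QuantumFieldTheory.Balaban1983to89
open Literature.MathematicalPhysics.QuantumFieldTheory.Balaban1983to89.T3ContinuumYM3Torus
open Literature.MathematicalPhysics.QuantumFieldTheory.Balaban1983to89.T3UnitScaleTilt
open Literature.MathematicalPhysics.QuantumFieldTheory.Balaban1983to89.T3UnitLawDensityEML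
open Literature.MathematicalPhysics.QuantumFieldTheory.Balaban1983to89.T3LevelShift
open Literature.MathematicalPhysics.QuantumFieldTheory.Balaban1983to89.T3ThresholdRemoval
open Literature.MathematicalPhysics.QuantumFieldTheory.Balaban1983to89.T3HistoryTailReduction
open Summit.QuantumFields.YangMills.Theorems.LargeFieldMassRefinementTailOfHeightTail
  (θBal_mul_pow plaqSmall_fieldShift_iff refine_refine)
open Summit.QuantumFields.YangMills.Theorems.LargeFieldMassRefinementTailFreeTopSteps (eventually_coupling_le)
open Summit.QuantumFields.YangMills.Theorems.LargeFieldMassRefinementTail (summable_term)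
open Summit.QuantumFields.YangMills.Theorems.LargeFieldMassRefinementTailBoundedRuns (heightMass_boundedHeight)

namespace Summit.QuantumFields.YangMills.Theorems.LargeFieldMassRefinementTailLowHeights

/-! ## §1 Transport with free top steps: run `K` of `F.refine d` with `s` free steps is run `K + d` of `F` with `s + d` free steps -/

section Transport

variable (F : T3Family) {G : Type*} [GaugeGroup G] (ℰ : LoopAverage G)

/-- **EVENT IDENTIFICATION WITH FREE TOP STEPS**: read on the base family's run `K + d` (same finest lattice, `sitesPerDir_refine_zero`),
the UV-small-history event of run `K` of `F.refine d` with `s` free top steps at the shifted thresholds `θ(· + d)` is the UV-small-history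
event of run `K + d` of `F` with `s + d` free top steps (the constrained heights `j ≤ K − s` coincide, the block averagings correspond
level by level, `iter_fieldShift`). [cite: Balaban1985UV3, (7) p.257] -/
theorem fieldShift_mem_histGood_iff_free (θ : ℕ → ℝ) (d K s : ℕ) (U : GaugeField ((F.refine d).P K) 0 G) :
    fieldShift (sitesPerDir_refine_zero F d K) U ∈ histGood F ℰ θ (K + d) (s + d) ↔
      U ∈ histGood (F.refine d) ℰ (fun i => θ (i + d)) K s := by
  have hmK : F.m + (K + d) = F.m + d + K := by omega
  simp only [histGood, Set.mem_setOf_eq]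
  constructor
  · intro h j hj
    have hjd := h j (by omega)
    have key := iter_fieldShift ℰ hmK j U
    erw [key, plaqSmall_fieldShift_iff] at hjd
    rw [show K + d - j = K - j + d by omega] at hjd
    exact hjd
  · intro h j hj
    have hjd := h j (by omega)
    have key := iter_fieldShift ℰ hmK j U
    erw [key, plaqSmall_fieldShift_iff]
    rw [show K + d - j = K - j + d by omega]
    exact hjd

variable [MeasurableSpace G] [HaarData G] [RegularGaugeGroup G]

/-- **MASS IDENTIFICATION WITH FREE TOP STEPS**: the Gibbs mass (run `K` of `F.refine d` at `γL^{-d}`) of the complement of the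
UV-small-history event with `s` free top steps at thresholds `θ(· + d)` EQUALS the Gibbs mass (run `K + d` of `F` at `γ`) of the complement
of the UV-small-history event with `s + d` free top steps at thresholds `θ` — same lattice, same Wilson weight (`refine_β`), product Haar
measures and averagings corresponding under `fieldShift` (`integral_gibbsMeasure_comp_fieldShift`). [cite: Balaban1985UV3, (1)-(3) p.256 and (7) p.257] -/
theorem gibbsK_refine_real_compl_histGood_free (hE : ℰ.MeasurableE) {γ : ℝ} (hγ : 0 ≤ γ) (θ : ℕ → ℝ) (d K s : ℕ) :
    (gibbsK (F.refine d) ℰ (γ * ((F.L : ℝ)⁻¹) ^ d) K).real (histGood (F.refine d) ℰ (fun i => θ (i + d)) K s)ᶜ =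
      (gibbsK F ℰ γ (K + d)).real (histGood F ℰ θ (K + d) (s + d))ᶜ := by
  have hβ : ((F.refine d).scheme ℰ (γ * ((F.L : ℝ)⁻¹) ^ d)).β K = (F.scheme ℰ γ).β (K + d) := F.refine_β ℰ γ d K
  have hβ0 : 0 ≤ (F.scheme ℰ γ).β (K + d) := F.scheme_β_nonneg ℰ hγ (K + d)
  have hSA : MeasurableSet (histGood (F.refine d) ℰ (fun i => θ (i + d)) K s)ᶜ :=
    (measurableSet_histGood (F.refine d) ℰ hE _ K s).compl
  have hSB : MeasurableSet (histGood F ℰ θ (K + d) (s + d))ᶜ := (measurableSet_histGood F ℰ hE θ (K + d) (s + d)).compl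
  have key := integral_gibbsMeasure_comp_fieldShift (G := G) (sitesPerDir_refine_zero F d K) hβ0
    ((histGood F ℰ θ (K + d) (s + d))ᶜ.indicator 1)
  have hind : (fun V : GaugeField ((F.refine d).P K) 0 G =>
      (histGood F ℰ θ (K + d) (s + d))ᶜ.indicator (1 : GaugeField (F.P (K + d)) 0 G → ℝ)
        (fieldShift (sitesPerDir_refine_zero F d K) V)) =
      (histGood (F.refine d) ℰ (fun i => θ (i + d)) K s)ᶜ.indicator 1 := by
    funext V
    by_cases hV : fieldShift (sitesPerDir_refine_zero F d K) V ∈ histGood F ℰ θ (K + d) (s + d)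
    · have hV' : V ∈ histGood (F.refine d) ℰ (fun i => θ (i + d)) K s :=
        (fieldShift_mem_histGood_iff_free F ℰ θ d K s V).mp hV
      erw [Set.indicator_of_notMem (Set.notMem_compl_iff.mpr hV), Set.indicator_of_notMem (Set.notMem_compl_iff.mpr hV')]
    · have hV' : V ∉ histGood (F.refine d) ℰ (fun i => θ (i + d)) K s :=
        fun h' => hV ((fieldShift_mem_histGood_iff_free F ℰ θ d K s V).mpr h')
      erw [Set.indicator_of_mem (Set.mem_compl hV), Set.indicator_of_mem (Set.mem_compl hV')]
      rfl
  erw [hind, integral_indicator_one hSA, integral_indicator_one hSB] at key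
  rw [gibbsK_eq, gibbsK_eq, hβ]
  exact key

end Transport

/-! ## §2 The low heights of EVERY run from a per-height profile of ONE family, by the tail of the profile -/

section Core

/-- Tails of a non-negative summable series decrease: `Σ_t q(t + b) ≤ Σ_t q(t + a)` for `a ≤ b`. [folklore] -/
theorem tsum_shift_anti {q : ℕ → ℝ} (hq0 : ∀ k, 0 ≤ q k) (hq : Summable q) {a b : ℕ} (hab : a ≤ b) :
    ∑' t, q (t + b) ≤ ∑' t, q (t + a) := by
  obtain ⟨k, rfl⟩ := Nat.exists_eq_add_of_le hab
  have ha : Summable fun t => q (t + a) := (summable_nat_add_iff a).mpr hq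
  have hsplit := ha.sum_add_tsum_nat_add k
  have hre : (fun t => q (t + k + a)) = fun t => q (t + (a + k)) := funext fun t => by rw [Nat.add_right_comm, Nat.add_assoc]
  rw [hre] at hsplit
  have hnonneg : 0 ≤ ∑ i ∈ Finset.range k, q (i + a) := Finset.sum_nonneg fun i _ => hq0 _
  linarith

/-- **THE `J₀ + 1` FINEST HEIGHTS OF EVERY RUN OF EVERY REFINEMENT FROM A PER-HEIGHT PROFILE AT THE HEIGHTS `≤ J₀` OF ONE FAMILY.**  If
for `F` at `γ ≥ 0` the Gibbs probability (run `K'`) of a large block-averaged plaquette at height `j ≤ min(K', J₀)` is at most `q(K' − j)`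
with `q ≥ 0` summable, then for every refinement depth `d` and EVERY run `K` the Gibbs mass (family `F.refine d`, coupling `γL^{-d}`) of
the complement of `histGood … K (K − J₀)` (the heights `j ≤ min(K, J₀)`) is at most the tail `Σ_{t ≥ 0} q(t + d)`: those heights sit at
distances `K + d − j ≥ d` from the unit scale of the base family. [cite: Balaban1985UV3, (7) p.257 and (71) p.273] -/
theorem refinedMass_lowHeights_le_tsum (F : T3Family) {γ : ℝ} (hγ : 0 ≤ γ) (b₀ p₀ : ℝ) (J₀ : ℕ) {q : ℕ → ℝ}
    (hq0 : ∀ k, 0 ≤ q k) (hq : Summable q)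
    (htail : ∀ K j, j ≤ K → j ≤ J₀ → (gibbsK F ℰp γ K).real
      {U | ¬ PlaqSmall (θBal F.L γ b₀ p₀ (K - j))
        (Averaging.iter (fun i => BlockAveraging.blockAvg (P := F.P K) (j := i) ℰp) j U)} ≤ q (K - j))
    (d K : ℕ) :
    (gibbsK (F.refine d) ℰp (γ * ((F.L : ℝ)⁻¹) ^ d) K).real
        (histGood (F.refine d) ℰp (θBal (F.refine d).L (γ * ((F.L : ℝ)⁻¹) ^ d) b₀ p₀) K (K - J₀))ᶜ ≤
      ∑' t, q (t + d) := by
  have hθ : θBal (F.refine d).L (γ * ((F.L : ℝ)⁻¹) ^ d) b₀ p₀ = fun i => θBal F.L γ b₀ p₀ (i + d) :=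
    funext fun i => θBal_mul_pow F.L γ b₀ p₀ d i
  rw [hθ, gibbsK_refine_real_compl_histGood_free F ℰp measurableE_ℰp hγ (θBal F.L γ b₀ p₀) d K (K - J₀)]
  haveI := isProbabilityMeasure_gibbsK F ℰp hγ (K + d)
  refine (real_compl_histGood_le_sum F ℰp (θBal F.L γ b₀ p₀) (K + d) (K - J₀ + d) (gibbsK F ℰp γ (K + d))).trans ?_
  -- the number of constrained heights is `M + 1`, `M = min(K, J₀)`
  set M : ℕ := K + d - (K - J₀ + d) with hM
  have hMK : M ≤ K := by omega
  have hMJ : M ≤ J₀ := by omega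
  have hrefl : ∑ j ∈ Finset.range (M + 1), q (K + d - j) = ∑ t ∈ Finset.range (M + 1), q (t + (K + d - M)) := by
    rw [← Finset.sum_range_reflect (fun t => q (t + (K + d - M))) (M + 1)]
    refine Finset.sum_congr rfl fun j hj => ?_
    rw [Finset.mem_range] at hj
    congr 1
    omega
  have hs : Summable fun t => q (t + (K + d - M)) := (summable_nat_add_iff _).mpr hq
  calc ∑ j ∈ Finset.range (M + 1), (gibbsK F ℰp γ (K + d)).real
          {U | ¬ PlaqSmall (θBal F.L γ b₀ p₀ (K + d - j))
            (Averaging.iter (fun i => BlockAveraging.blockAvg (P := F.P (K + d)) (j := i) ℰp) j U)}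
      ≤ ∑ j ∈ Finset.range (M + 1), q (K + d - j) :=
        Finset.sum_le_sum fun j hj => by
          have hj' := Finset.mem_range.mp hj
          exact htail (K + d) j (by omega) (by omega)
    _ = ∑ t ∈ Finset.range (M + 1), q (t + (K + d - M)) := hrefl
    _ ≤ ∑' t, q (t + (K + d - M)) := hs.sum_le_tsum _ fun t _ => hq0 _
    _ ≤ ∑' t, q (t + d) := tsum_shift_anti hq0 hq (by omega)

end Core

/-! ## §3 The low heights of every run are idle, unconditionally -/

section LowHeights

/-- **THE `J₀ + 1` FINEST HEIGHTS OF EVERY RUN, UNIFORMLY IN THE RUN — NO HYPOTHESIS** (every `J₀`, family, `γ > 0`, profile `b₀ > 0`,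
`p₀ ≥ 1`): there is `δ n → 0` with `Gibbs^{F.refine n}_K((histGood (F.refine n) θ K (K − J₀))ᶜ) ≤ δ n` for all `n` with `γL^{-n} ≤ 1` and
ALL runs `K` — the event that some block-averaged plaquette at a height `j ≤ min(K, J₀)` is `θ(K−j)`-large.  Proof: least admissible
refinement `n₀`; the base family `F.refine n₀` at `γL^{-n₀} ≤ 1` has the unconditional per-height profile
`q(i) = C·L^{3(m₀+i)}·β_i^A·e^{−c p(g_i)²}` at the heights `≤ J₀` (`heightMass_boundedHeight` of `…BoundedRuns`), summable
(`summable_term`); §2.  Subsumes `…BoundedRuns.refinedMass_null_boundedRuns` (`K ≤ J₀`) and `bareMass_refine_null` (`J₀ = 0`).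
The crux is the case `J₀ = K` (all heights of every run), NOT proved. [cite: Balaban1985UV3, (7) p.257 and (71) p.273] -/
theorem refinedMass_null_lowHeights (J₀ : ℕ) (F : T3Family) {γ b₀ p₀ : ℝ} (hγ : 0 < γ) (hb₀ : 0 < b₀) (hp₀ : 1 ≤ p₀) :
    ∃ δ : ℕ → ℝ, Tendsto δ atTop (𝓝 0) ∧ ∀ n K : ℕ, γ * ((F.L : ℝ)⁻¹) ^ n ≤ 1 →
      (gibbsK (F.refine n) ℰp (γ * ((F.L : ℝ)⁻¹) ^ n) K).real
        (histGood (F.refine n) ℰp (θBal (F.refine n).L (γ * ((F.L : ℝ)⁻¹) ^ n) b₀ p₀) K (K - J₀))ᶜ ≤ δ n := by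
  classical
  have hex : ∃ n : ℕ, γ * ((F.L : ℝ)⁻¹) ^ n ≤ 1 := (eventually_coupling_le F γ one_pos).exists
  have hn₀ : γ * ((F.L : ℝ)⁻¹) ^ Nat.find hex ≤ 1 := Nat.find_spec hex
  have hL1 : (1 : ℝ) < F.L := by exact_mod_cast F.hL.2
  have hL0 : (0 : ℝ) < F.L := zero_lt_one.trans hL1
  have hγ₀ : 0 < γ * ((F.L : ℝ)⁻¹) ^ Nat.find hex := mul_pos hγ (pow_pos (inv_pos.mpr hL0) _)
  obtain ⟨C, A, c, hC, hc, hprof⟩ :=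
    heightMass_boundedHeight J₀ (F.refine (Nat.find hex)) hγ₀ hn₀ hb₀.le p₀
  obtain ⟨q, hq⟩ : ∃ q : ℕ → ℝ, q = fun k : ℕ =>
      C * (F.L : ℝ) ^ (3 * ((F.refine (Nat.find hex)).m + k)) *
        ((γ * ((F.L : ℝ)⁻¹) ^ Nat.find hex * ((F.L : ℝ)⁻¹) ^ k)⁻¹) ^ A *
          Real.exp (-(c * B10.pFun b₀ p₀
            (Real.sqrt (γ * ((F.L : ℝ)⁻¹) ^ Nat.find hex * ((F.L : ℝ)⁻¹) ^ k)) ^ 2)) := ⟨_, rfl⟩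
  have hq0 : ∀ k, 0 ≤ q k := fun k => by
    rw [hq]; dsimp only; positivity
  have hqs : Summable q := by
    rw [hq]
    exact summable_term F.hL.2 (F.refine (Nat.find hex)).m A hb₀ hp₀ hc hC hγ₀
  have htail : ∀ K j, j ≤ K → j ≤ J₀ → (gibbsK (F.refine (Nat.find hex)) ℰp (γ * ((F.L : ℝ)⁻¹) ^ Nat.find hex) K).real
      {U | ¬ PlaqSmall (θBal (F.refine (Nat.find hex)).L (γ * ((F.L : ℝ)⁻¹) ^ Nat.find hex) b₀ p₀ (K - j))
        (Averaging.iter (fun i => BlockAveraging.blockAvg (P := (F.refine (Nat.find hex)).P K) (j := i) ℰp) j U)} ≤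
      q (K - j) := fun K j hjK hjJ => by
    rw [hq]
    exact hprof K j hjK hjJ
  refine ⟨fun n => ∑' t, q (t + (n - Nat.find hex)),
    (tendsto_sum_nat_add q).comp (tendsto_sub_atTop_nat (Nat.find hex)), fun n K hle => ?_⟩
  have hn : Nat.find hex ≤ n := Nat.find_min' hex hle
  obtain ⟨d, rfl⟩ : ∃ d, n = Nat.find hex + d := ⟨n - Nat.find hex, by omega⟩
  have hd : Nat.find hex + d - Nat.find hex = d := Nat.add_sub_cancel_left _ _
  have hcoup : γ * ((F.L : ℝ)⁻¹) ^ (Nat.find hex + d) =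
      γ * ((F.L : ℝ)⁻¹) ^ Nat.find hex * ((F.L : ℝ)⁻¹) ^ d := by rw [pow_add, mul_assoc]
  beta_reduce
  rw [hd, hcoup, ← refine_refine F (Nat.find hex) d]
  exact refinedMass_lowHeights_le_tsum (F.refine (Nat.find hex)) hγ₀.le b₀ p₀ J₀ hq0 hqs htail d K

/-- **THE CRUX FOR THE `J₀ + 1` FINEST HEIGHTS OF EVERY RUN, IN ITS OWN QUANTIFIER SHAPE** — `LargeFieldMassRefinementTail` with the
all-heights event `histGood … K 0` replaced by `histGood … K (K − J₀)` (the heights `j ≤ min(K, J₀)`: for `K ≤ J₀` ALL heights), everything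
else verbatim (witnesses `b₀ = 1`, `p₀ = 3`, `γ₁ = 1`; every profile works), PROVED for every `J₀`; uniform in the run `K`.  The crux is
the height-complete case, NOT proved. [cite: Balaban1985UV3, (7) p.257 and (71) p.273] -/
theorem largeFieldMassRefinementTail_lowHeights (J₀ : ℕ) :
    ∀ L : ℕ, ∃ b₀ p₀ γ₁ : ℝ, 0 < b₀ ∧ 2 < p₀ ∧ 0 < γ₁ ∧
      ∀ (F : T3Family) (γ : ℝ), F.L = L → 0 < γ →
        ∃ δ : ℕ → ℝ, Tendsto δ atTop (𝓝 0) ∧ ∀ n K : ℕ, γ * ((F.L : ℝ)⁻¹) ^ n ≤ γ₁ →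
          (gibbsK (F.refine n) ℰp (γ * ((F.L : ℝ)⁻¹) ^ n) K).real
            (histGood (F.refine n) ℰp (θBal (F.refine n).L (γ * ((F.L : ℝ)⁻¹) ^ n) b₀ p₀) K (K - J₀))ᶜ ≤ δ n :=
  fun _ => ⟨1, 3, 1, one_pos, by norm_num, one_pos, fun F _ _ hγ =>
    refinedMass_null_lowHeights J₀ F hγ one_pos (by norm_num)⟩

end LowHeights

/-! ## §4 The crux IS its coarse-heights part: r3 ⇔ r3 for the heights `j > J₀`, for every `J₀` -/

section HighHeights

/-- **r3 ⇔ r3 FOR THE HEIGHTS `J₀ < j ≤ K` ONLY, FOR EVERY `J₀`.**  `LargeFieldMassRefinementTail` is EQUIVALENT to the same statement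
with the complement of the all-heights event replaced by «some block-averaged plaquette at a height `J₀ < j ≤ K` — a field averaged over
MORE than `J₀` block-averaging steps — is `θ(K−j)`-large»: (⇒) containment; (⇐) the complement is that event ∪ the low-heights event
`(histGood … K (K − J₀))ᶜ`, whose mass is `o(1)` uniformly in `K` by §3 (gate shrunk to `min γ₁ 1`).  Kernel certificate: the crux's
content is the large-field improbability of the COARSE block-averaged fields (unboundedly many averaging steps), jointly in the height
and the run. [cite: Balaban1985UV3, (7) p.257 and (71) p.273] -/
theorem largeFieldMassRefinementTail_iff_highHeights (J₀ : ℕ) :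
    Summit.QuantumFields.YangMills.Theses.SmallFieldWidening.LargeFieldMassRefinementTail ↔
      ∀ L : ℕ, ∃ b₀ p₀ γ₁ : ℝ, 0 < b₀ ∧ 2 < p₀ ∧ 0 < γ₁ ∧
        ∀ (F : T3Family) (γ : ℝ), F.L = L → 0 < γ →
          ∃ δ : ℕ → ℝ, Tendsto δ atTop (𝓝 0) ∧ ∀ n K : ℕ, γ * ((F.L : ℝ)⁻¹) ^ n ≤ γ₁ →
            (gibbsK (F.refine n) ℰp (γ * ((F.L : ℝ)⁻¹) ^ n) K).real
              {U | ∃ j, J₀ < j ∧ j ≤ K ∧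
                ¬ PlaqSmall (θBal (F.refine n).L (γ * ((F.L : ℝ)⁻¹) ^ n) b₀ p₀ (K - j))
                  (Averaging.iter (fun i => BlockAveraging.blockAvg (P := (F.refine n).P K) (j := i) ℰp) j U)} ≤
              δ n := by
  constructor
  · intro h L
    obtain ⟨b₀, p₀, γ₁, hb₀, hp₀, hγ₁, H⟩ := h L
    refine ⟨b₀, p₀, γ₁, hb₀, hp₀, hγ₁, fun F γ hFL hγ => ?_⟩
    obtain ⟨δ, hδ, hmass⟩ := H F γ hFL hγ
    have hL0 : (0 : ℝ) < F.L := by exact_mod_cast (zero_lt_one.trans F.hL.2)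
    refine ⟨δ, hδ, fun n K hle => ?_⟩
    haveI := isProbabilityMeasure_gibbsK (F.refine n) ℰp (mul_pos hγ (pow_pos (inv_pos.mpr hL0) n)).le K
    refine (measureReal_mono ?_).trans (hmass n K hle)
    rintro U ⟨j, -, hjK, hbad⟩ hgood
    exact hbad (hgood j (by omega))
  · intro h L
    obtain ⟨b₀, p₀, γ₁, hb₀, hp₀, hγ₁, H⟩ := h L
    refine ⟨b₀, p₀, min γ₁ 1, hb₀, hp₀, lt_min hγ₁ one_pos, fun F γ hFL hγ => ?_⟩
    obtain ⟨δ₁, hδ₁, hhigh⟩ := H F γ hFL hγ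
    obtain ⟨δ₀, hδ₀, hlow⟩ := refinedMass_null_lowHeights J₀ F (p₀ := p₀) hγ hb₀ (by linarith)
    have hL0 : (0 : ℝ) < F.L := by exact_mod_cast (zero_lt_one.trans F.hL.2)
    refine ⟨fun n => δ₀ n + δ₁ n, by simpa using hδ₀.add hδ₁, fun n K hle => ?_⟩
    have hle₁ : γ * ((F.L : ℝ)⁻¹) ^ n ≤ γ₁ := hle.trans (min_le_left _ _)
    have hle₀ : γ * ((F.L : ℝ)⁻¹) ^ n ≤ 1 := hle.trans (min_le_right _ _)
    haveI := isProbabilityMeasure_gibbsK (F.refine n) ℰp (mul_pos hγ (pow_pos (inv_pos.mpr hL0) n)).le K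
    -- not small at every height ⇒ large at a height `≤ J₀` (low event) or at a height `> J₀` (high event)
    have hsub : (histGood (F.refine n) ℰp (θBal (F.refine n).L (γ * ((F.L : ℝ)⁻¹) ^ n) b₀ p₀) K 0)ᶜ ⊆
        (histGood (F.refine n) ℰp (θBal (F.refine n).L (γ * ((F.L : ℝ)⁻¹) ^ n) b₀ p₀) K (K - J₀))ᶜ ∪
          {U | ∃ j, J₀ < j ∧ j ≤ K ∧
            ¬ PlaqSmall (θBal (F.refine n).L (γ * ((F.L : ℝ)⁻¹) ^ n) b₀ p₀ (K - j))
              (Averaging.iter (fun i => BlockAveraging.blockAvg (P := (F.refine n).P K) (j := i) ℰp) j U)} := by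
      intro U hU
      simp only [Set.mem_compl_iff, histGood, Set.mem_setOf_eq, not_forall] at hU
      obtain ⟨j, hj, hbad⟩ := hU
      by_cases hjJ : j ≤ J₀
      · left
        simp only [Set.mem_compl_iff, histGood, Set.mem_setOf_eq, not_forall]
        exact ⟨j, by omega, hbad⟩
      · exact Or.inr ⟨j, not_le.mp hjJ, by omega, hbad⟩
    calc (gibbsK (F.refine n) ℰp (γ * ((F.L : ℝ)⁻¹) ^ n) K).real
          (histGood (F.refine n) ℰp (θBal (F.refine n).L (γ * ((F.L : ℝ)⁻¹) ^ n) b₀ p₀) K 0)ᶜ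
        ≤ (gibbsK (F.refine n) ℰp (γ * ((F.L : ℝ)⁻¹) ^ n) K).real
            ((histGood (F.refine n) ℰp (θBal (F.refine n).L (γ * ((F.L : ℝ)⁻¹) ^ n) b₀ p₀) K (K - J₀))ᶜ ∪
              {U | ∃ j, J₀ < j ∧ j ≤ K ∧
                ¬ PlaqSmall (θBal (F.refine n).L (γ * ((F.L : ℝ)⁻¹) ^ n) b₀ p₀ (K - j))
                  (Averaging.iter (fun i => BlockAveraging.blockAvg (P := (F.refine n).P K) (j := i) ℰp) j U)}) :=
          measureReal_mono hsub
      _ ≤ _ := measureReal_union_le _ _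
      _ ≤ δ₀ n + δ₁ n := add_le_add (hlow n K hle₀) (hhigh n K hle₁)

end HighHeights

end Summit.QuantumFields.YangMills.Theorems.LargeFieldMassRefinementTailLowHeights

end
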